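import Literature.Probability.RandomPlanarGeometry.PlaneNonIntersectionLowerBound
import Mathlib.Analysis.SpecialFunctions.Trigonometric.Series
import Mathlib.Analysis.SpecialFunctions.Pow.Real
import HarnessLib

/-!
# Planar simple random walk: a Gaussian tail for the running maximum, and an exponential moment

Fourth proof file of the `PlaneNonIntersection` story (the named fact
`LSW2001_srw_nonIntersection_five_eighths` of `PlaneNonIntersection.lean`). The a-priori bounds
landed so far are `c/k ≤ N(k)/16^k ≤ C/log k` (`PlaneNonIntersectionLowerBound.lean`,
`PlaneNonIntersectionUpperBound.lean`). The next rung in print, Lawler's `f(n) ≤ c n^{-1/2}`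
(*Intersections of Random Walks* (1991), (3.29), from the two-sided-walk estimate of §3.6), needs
two inputs about the planar walk itself which this file and its sequel supply in counting form
over the `4^ℓ` step sequences `ω : SRW.StepSeq 2 ℓ` (uniform measure = the walk):

* **Gaussian tail of the running maximum** (`card_filter_exists_normSq_ge_le`):
  `#{ω : ∃ j ≤ ℓ, |ω(j)|² ≥ s²} ≤ 16 · 4^ℓ · exp(-(21/25) s²/ℓ)`, `ℓ ≥ 1`, `s > 0` — the constant
  `21/25 > 1/2` in the exponent matters downstream (it is played against the factor
  `exp(+R²/(16n))` of Lawler's (3.27)); it is obtained from the SHARP one-step moment generating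
  functions of the four lattice projections `x, y, x+y, x-y` (`(cosh t + 1)/2 ≤ e^{t²/4}`,
  `cosh t ≤ e^{t²/2}`: `sum_exp_mul_stepVec_apply_le`, `sum_exp_mul_diag_le`), Chernoff's bound
  (`card_filter_psum_ge_le_exp`), the reflection principle at a real level for paths with
  symmetric integer steps (`card_filter_max_ge_le`, Lévy's inequality `P(max ≥ a) ≤ 2 P(S_ℓ ≥ a)`),
  and the covering of the circle by the `8` lattice directions
  (`covering : (21/25)(x²+y²) ≤ max(x², y², (x+y)²/2, (x-y)²/2)`);
* **an exponential moment** (`sum_exp_maxNormSq_div_le`): for `1 ≤ ℓ ≤ 2n`,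
  `Σ_ω exp(max_{j ≤ ℓ} |ω(j)|² / (4n)) ≤ 100 · 4^ℓ` (Abel summation against the tail).

Everything is folklore (Lawler 1991, §1.3, Exercise 1.3.4 "reflection principle"; Hoeffding /
Chernoff); the counting Hoeffding inequality of `Literature.Probability.Moments.HoeffdingCounting`
is range-based and loses the factor `2` in the exponent for the axis projections, which is why the
moment generating functions are computed here exactly.

## References

* G. F. Lawler, *Intersections of Random Walks*, Birkhäuser 1991, §1.3 and Exercise 1.3.4
  (reflection principle), proof of (3.26)–(3.27) [Lawler1991].
* W. Hoeffding, *Probability inequalities for sums of bounded random variables*, JASA 58 (1963).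
-/

noncomputable section

open Finset Real Literature.Probability.LatticeModels Literature.Probability.LatticeModels.SRW
open scoped BigOperators

namespace Literature.Probability.RandomPlanarGeometry

namespace PlaneNonIntersection

/-! ### Paths with steps in a finite alphabet: partial sums, reflection, Chernoff -/

section GenericPaths

variable {σ : Type*} {n : ℕ}

/-- Partial sums `Σ_{i<j} f(yᵢ)` of an integer weight `f` along a step sequence `y : Fin n → σ`,
frozen after time `n`. [folklore] -/
def psum (f : σ → ℤ) (y : Fin n → σ) (j : ℕ) : ℤ :=
  ∑ i : Fin n, if (i : ℕ) < j then f (y i) else 0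

/-- `S(0) = 0`. [folklore] -/
@[simp] theorem psum_zero (f : σ → ℤ) (y : Fin n → σ) : psum f y 0 = 0 := by
  simp [psum]

/-- The partial sums are frozen after time `n`. [folklore] -/
theorem psum_of_le (f : σ → ℤ) (y : Fin n → σ) {j : ℕ} (hj : n ≤ j) : psum f y j = psum f y n := by
  unfold psum
  refine Finset.sum_congr rfl fun i _ => ?_
  simp [lt_of_lt_of_le i.isLt hj, i.isLt]

/-- The final value is the full sum. [folklore] -/
theorem psum_self (f : σ → ℤ) (y : Fin n → σ) : psum f y n = ∑ i, f (y i) := by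
  unfold psum
  exact Finset.sum_congr rfl fun i _ => if_pos i.isLt

/-- Flipping the steps with index `≥ τ` by a map `ν` (the reflection after time `τ`). [folklore] -/
def flipAfter (ν : σ → σ) (y : Fin n → σ) (τ : ℕ) : Fin n → σ :=
  fun i => if (i : ℕ) < τ then y i else ν (y i)

/-- Flipping twice by an involution gives the path back. [folklore] -/
theorem flipAfter_flipAfter {ν : σ → σ} (hν : Function.Involutive ν) (y : Fin n → σ) (τ : ℕ) :
    flipAfter ν (flipAfter ν y τ) τ = y := by
  funext i
  by_cases h : (i : ℕ) < τ <;> simp [flipAfter, h, hν (y i)]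

/-- Up to the flipping time the partial sums do not change. [folklore] -/
theorem psum_flipAfter_of_le (f : σ → ℤ) (ν : σ → σ) (y : Fin n → σ) {τ j : ℕ} (hj : j ≤ τ) :
    psum f (flipAfter ν y τ) j = psum f y j := by
  unfold psum flipAfter
  refine Finset.sum_congr rfl fun i _ => ?_
  by_cases hi : (i : ℕ) < j
  · simp [hi, lt_of_lt_of_le hi hj]
  · simp [hi]

/-- After the flipping time the partial sums are reflected through the value at `τ`, when `ν`
reverses the weight. [folklore] -/
theorem psum_flipAfter_add (f : σ → ℤ) {ν : σ → σ} (hf : ∀ b, f (ν b) = -f b) (y : Fin n → σ)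
    {τ j : ℕ} (hj : τ ≤ j) : psum f (flipAfter ν y τ) j + psum f y j = 2 * psum f y τ := by
  unfold psum flipAfter
  rw [← Finset.sum_add_distrib, Finset.mul_sum]
  refine Finset.sum_congr rfl fun i _ => ?_
  by_cases hi : (i : ℕ) < τ
  · simp only [if_pos hi, if_pos (lt_of_lt_of_le hi hj)]
    ring
  · by_cases hij : (i : ℕ) < j
    · simp only [if_neg hi, if_pos hij, hf, mul_zero]
      ring
    · simp [hi, hij]

/-- Reversing every step negates the partial sums. [folklore] -/
theorem psum_comp (f : σ → ℤ) {ν : σ → σ} (hf : ∀ b, f (ν b) = -f b) (y : Fin n → σ) (j : ℕ) :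
    psum f (fun i => ν (y i)) j = -psum f y j := by
  unfold psum
  rw [← Finset.sum_neg_distrib]
  refine Finset.sum_congr rfl fun i _ => ?_
  by_cases h : (i : ℕ) < j <;> simp [h, hf]

open Classical in
/-- **Reflection principle / Lévy's inequality** for paths with symmetric integer steps, at a real
level `a`: `#{max_{j ≤ n} S(j) ≥ a} ≤ 2 #{S(n) ≥ a}`. The paths whose maximum is `≥ a` but which
end below `a`, reflected (by the weight-reversing involution `ν`) after their first passage above
`a`, end above `a`; the map is injective because the image has the same first passage time and
the reflection is an involution. [cite: Lawler1991, Exercise 1.3.4] -/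
theorem card_filter_max_ge_le [Fintype σ] (f : σ → ℤ) {ν : σ → σ} (hν : Function.Involutive ν)
    (hf : ∀ b, f (ν b) = -f b) (a : ℝ) :
    #{y : Fin n → σ | ∃ j ≤ n, a ≤ (psum f y j : ℝ)} ≤ 2 * #{y : Fin n → σ | a ≤ (psum f y n : ℝ)} := by
  set A : Finset (Fin n → σ) := {y | (∃ j ≤ n, a ≤ (psum f y j : ℝ)) ∧ (psum f y n : ℝ) < a} with hA
  set B : Finset (Fin n → σ) := {y | a ≤ (psum f y n : ℝ)} with hB
  have hmemA : ∀ y, y ∈ A ↔ (∃ j ≤ n, a ≤ (psum f y j : ℝ)) ∧ (psum f y n : ℝ) < a := fun y => by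
    simp [hA]
  have hmemB : ∀ y, y ∈ B ↔ a ≤ (psum f y n : ℝ) := fun y => by simp [hB]
  -- split according to the final value
  have hsplit : #{y : Fin n → σ | ∃ j ≤ n, a ≤ (psum f y j : ℝ)} ≤ #B + #A := by
    rw [← Finset.card_union_of_disjoint]
    · refine Finset.card_le_card fun y hy => ?_
      rw [Finset.mem_filter] at hy
      rw [Finset.mem_union, hmemA, hmemB]
      by_cases h : a ≤ (psum f y n : ℝ)
      · exact Or.inl h
      · exact Or.inr ⟨hy.2, not_le.1 h⟩
    · rw [Finset.disjoint_left]
      intro y hyB hyA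
      rw [hmemB] at hyB
      rw [hmemA] at hyA
      linarith [hyA.2]
  -- the reflection maps `A` into `B` injectively
  have hex : ∀ y ∈ A, ∃ j, a ≤ (psum f y j : ℝ) := fun y hy => by
    obtain ⟨⟨j, -, hj⟩, -⟩ := (hmemA y).1 hy
    exact ⟨j, hj⟩
  let τ : (Fin n → σ) → ℕ := fun y => if h : y ∈ A then Nat.find (hex y h) else 0
  have hτ : ∀ y ∈ A, a ≤ (psum f y (τ y) : ℝ) ∧ ∀ j < τ y, (psum f y j : ℝ) < a := by
    intro y hy
    refine ⟨by simpa [τ, hy] using Nat.find_spec (hex y hy), fun j hj => ?_⟩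
    have hj' : j < Nat.find (hex y hy) := by simpa [τ, hy] using hj
    exact not_le.1 (Nat.find_min (hex y hy) hj')
  have hτn : ∀ y ∈ A, τ y ≤ n := by
    intro y hy
    by_contra h
    have h1 := (hτ y hy).1
    rw [psum_of_le f y (le_of_lt (not_le.1 h))] at h1
    have h2 := ((hmemA y).1 hy).2
    linarith
  have hmaps : ∀ y ∈ A, flipAfter ν y (τ y) ∈ B := by
    intro y hy
    have h1 := (hτ y hy).1
    have h2 := ((hmemA y).1 hy).2
    have hadd := psum_flipAfter_add f hf y (hτn y hy)
    have hadd' : (psum f (flipAfter ν y (τ y)) n : ℝ) + psum f y n = 2 * psum f y (τ y) := by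
      exact_mod_cast hadd
    rw [hmemB]
    linarith
  have key : ∀ y₁ ∈ A, ∀ y₂ ∈ A,
      flipAfter ν y₁ (τ y₁) = flipAfter ν y₂ (τ y₂) → τ y₁ ≤ τ y₂ := by
    intro y₁ h₁ y₂ h₂ hΦ
    by_contra hlt
    have hlt : τ y₂ < τ y₁ := not_le.1 hlt
    have e1 : psum f (flipAfter ν y₂ (τ y₂)) (τ y₂) = psum f y₂ (τ y₂) :=
      psum_flipAfter_of_le f ν y₂ le_rfl
    have e2 : psum f (flipAfter ν y₁ (τ y₁)) (τ y₂) = psum f y₁ (τ y₂) :=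
      psum_flipAfter_of_le f ν y₁ hlt.le
    have h3 := (hτ y₁ h₁).2 (τ y₂) hlt
    have h4 := (hτ y₂ h₂).1
    rw [← e2, hΦ, e1] at h3
    linarith
  have hinj : Set.InjOn (fun y => flipAfter ν y (τ y)) A := by
    intro y₁ h₁ y₂ h₂ hΦ
    have h₁' : y₁ ∈ A := by simpa using h₁
    have h₂' : y₂ ∈ A := by simpa using h₂
    have hττ : τ y₁ = τ y₂ := le_antisymm (key y₁ h₁' y₂ h₂' hΦ) (key y₂ h₂' y₁ h₁' hΦ.symm)
    calc y₁ = flipAfter ν (flipAfter ν y₁ (τ y₁)) (τ y₁) := (flipAfter_flipAfter hν y₁ (τ y₁)).symm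
      _ = flipAfter ν (flipAfter ν y₂ (τ y₂)) (τ y₂) := by
          show flipAfter ν ((fun y => flipAfter ν y (τ y)) y₁) (τ y₁) =
            flipAfter ν ((fun y => flipAfter ν y (τ y)) y₂) (τ y₂)
          rw [hΦ, hττ]
      _ = y₂ := flipAfter_flipAfter hν y₂ (τ y₂)
  have hAB : #A ≤ #B :=
    Finset.card_le_card_of_injOn (fun y => flipAfter ν y (τ y)) (fun y hy => hmaps y hy) hinj
  omega

open Classical in
/-- Two-sided form: `#{max_{j ≤ n} |S(j)| ≥ a} ≤ 4 #{S(n) ≥ a}` for `a > 0` (negating all steps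
exchanges the two one-sided events). [folklore] -/
theorem card_filter_max_abs_ge_le [Fintype σ] (f : σ → ℤ) {ν : σ → σ} (hν : Function.Involutive ν)
    (hf : ∀ b, f (ν b) = -f b) (a : ℝ) :
    #{y : Fin n → σ | ∃ j ≤ n, a ≤ |(psum f y j : ℝ)|} ≤
      4 * #{y : Fin n → σ | a ≤ (psum f y n : ℝ)} := by
  have hneg : #{y : Fin n → σ | ∃ j ≤ n, a ≤ -(psum f y j : ℝ)} =
      #{y : Fin n → σ | ∃ j ≤ n, a ≤ (psum f y j : ℝ)} := by
    refine Finset.card_bijective (fun y i => ν (y i))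
      (Function.Involutive.bijective fun y => by funext i; exact hν (y i)) fun y => ?_
    simp only [Finset.mem_filter, Finset.mem_univ, true_and, psum_comp f hf, Int.cast_neg]
  calc #{y : Fin n → σ | ∃ j ≤ n, a ≤ |(psum f y j : ℝ)|}
      ≤ #(({y : Fin n → σ | ∃ j ≤ n, a ≤ (psum f y j : ℝ)} : Finset (Fin n → σ)) ∪
          ({y : Fin n → σ | ∃ j ≤ n, a ≤ -(psum f y j : ℝ)} : Finset (Fin n → σ))) := by
        refine Finset.card_le_card fun y hy => ?_
        rw [Finset.mem_filter] at hy
        obtain ⟨j, hj, hja⟩ := hy.2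
        rw [Finset.mem_union, Finset.mem_filter, Finset.mem_filter]
        rcases le_abs.1 hja with h | h
        · exact Or.inl ⟨Finset.mem_univ _, j, hj, h⟩
        · exact Or.inr ⟨Finset.mem_univ _, j, hj, h⟩
    _ ≤ #{y : Fin n → σ | ∃ j ≤ n, a ≤ (psum f y j : ℝ)} +
          #{y : Fin n → σ | ∃ j ≤ n, a ≤ -(psum f y j : ℝ)} := Finset.card_union_le _ _
    _ = 2 * #{y : Fin n → σ | ∃ j ≤ n, a ≤ (psum f y j : ℝ)} := by rw [hneg]; ring
    _ ≤ 2 * (2 * #{y : Fin n → σ | a ≤ (psum f y n : ℝ)}) :=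
        Nat.mul_le_mul_left _ (card_filter_max_ge_le f hν hf a)
    _ = 4 * #{y : Fin n → σ | a ≤ (psum f y n : ℝ)} := by ring

/-- **Chernoff's bound**, counting form: `#{S(n) ≥ a} ≤ e^{-ta} (Σ_b e^{t f(b)})^n` for `t ≥ 0`.
[folklore] -/
theorem card_filter_psum_ge_le_exp [Fintype σ] (f : σ → ℤ) (n : ℕ) (a : ℝ) {t : ℝ} (ht : 0 ≤ t) :
    (#{y : Fin n → σ | a ≤ (psum f y n : ℝ)} : ℝ) ≤
      Real.exp (-(t * a)) * (∑ b : σ, Real.exp (t * f b)) ^ n := by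
  classical
  set E : Finset (Fin n → σ) := {y | a ≤ (psum f y n : ℝ)} with hE
  have h1 : (#E : ℝ) * Real.exp (t * a) ≤ ∑ y : Fin n → σ, Real.exp (t * (psum f y n : ℝ)) := by
    rw [← nsmul_eq_mul, ← Finset.sum_const]
    refine (Finset.sum_le_sum fun y hy => ?_).trans
      (Finset.sum_le_sum_of_subset_of_nonneg (Finset.filter_subset _ _)
        fun y _ _ => (Real.exp_pos _).le)
    rw [hE, Finset.mem_filter] at hy
    exact Real.exp_le_exp.2 (mul_le_mul_of_nonneg_left hy.2 ht)
  have h2 : ∑ y : Fin n → σ, Real.exp (t * (psum f y n : ℝ)) = (∑ b : σ, Real.exp (t * f b)) ^ n := by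
    have h : ∀ y : Fin n → σ, Real.exp (t * (psum f y n : ℝ)) = ∏ i, Real.exp (t * f (y i)) := by
      intro y
      rw [psum_self, Int.cast_sum, Finset.mul_sum, Real.exp_sum]
    rw [Finset.sum_congr rfl fun y _ => h y]
    have hc : (∑ b : σ, Real.exp (t * f b)) ^ n = ∏ _i : Fin n, ∑ b : σ, Real.exp (t * f b) := by
      rw [Finset.prod_const, Finset.card_univ, Fintype.card_fin]
    rw [hc, Finset.prod_univ_sum, Fintype.piFinset_univ]
  rw [Real.exp_neg, inv_mul_eq_div, le_div_iff₀ (Real.exp_pos _), ← h2]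
  exact h1

end GenericPaths

/-! ### The four lattice projections of the planar walk -/

section Planar

variable {ℓ : ℕ}

/-- The projections of a step sequence: `psum (f ∘ stepVec) ω j` is the `f`-image of the position
when `f` is additive — coordinate `0`. [folklore] -/
theorem psum_stepVec_apply (ω : StepSeq 2 ℓ) (c : Fin 2) (j : ℕ) :
    psum (fun v : Dir 2 => stepVec v c) ω j = pos ω j c := by
  unfold psum pos
  rw [Finset.sum_apply]
  refine Finset.sum_congr rfl fun i _ => ?_
  by_cases h : (i : ℕ) < j <;> simp [h]

/-- The diagonal projection `x + y`. [folklore] -/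
theorem psum_diag (ω : StepSeq 2 ℓ) (j : ℕ) :
    psum (fun v : Dir 2 => stepVec v 0 + stepVec v 1) ω j = pos ω j 0 + pos ω j 1 := by
  rw [← psum_stepVec_apply ω 0 j, ← psum_stepVec_apply ω 1 j]
  unfold psum
  rw [← Finset.sum_add_distrib]
  refine Finset.sum_congr rfl fun i _ => ?_
  by_cases h : (i : ℕ) < j <;> simp [h]

/-- The anti-diagonal projection `x - y`. [folklore] -/
theorem psum_antidiag (ω : StepSeq 2 ℓ) (j : ℕ) :
    psum (fun v : Dir 2 => stepVec v 0 - stepVec v 1) ω j = pos ω j 0 - pos ω j 1 := by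
  rw [← psum_stepVec_apply ω 0 j, ← psum_stepVec_apply ω 1 j]
  unfold psum
  rw [← Finset.sum_sub_distrib]
  refine Finset.sum_congr rfl fun i _ => ?_
  by_cases h : (i : ℕ) < j <;> simp [h]

/-- Reversing a step negates each coordinate. [folklore] -/
theorem stepVec_neg_apply (v : Dir 2) (c : Fin 2) : stepVec v.neg c = -stepVec v c := by
  rw [stepVec_neg, Pi.neg_apply]

/-- `(e^t + e^{-t} + 2) = (e^{t/2} + e^{-t/2})² ≤ 4 e^{t²/4}`: the sharp moment generating function
of one axis projection of a planar unit step (values `1, -1, 0, 0`). [folklore] -/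
theorem exp_add_exp_neg_add_two_le (t : ℝ) :
    Real.exp t + Real.exp (-t) + 2 ≤ 4 * Real.exp (t ^ 2 / 4) := by
  have e1 : Real.exp t = Real.exp (t / 2) ^ 2 := by
    rw [sq, ← Real.exp_add]; ring_nf
  have e2 : Real.exp (-t) = Real.exp (-(t / 2)) ^ 2 := by
    rw [sq, ← Real.exp_add]; ring_nf
  have e3 : Real.exp (t / 2) * Real.exp (-(t / 2)) = 1 := by
    rw [← Real.exp_add, add_neg_cancel, Real.exp_zero]
  have h1 : Real.exp t + Real.exp (-t) + 2 = (2 * Real.cosh (t / 2)) ^ 2 := by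
    rw [Real.cosh_eq]
    have h : (2 * ((Real.exp (t / 2) + Real.exp (-(t / 2))) / 2)) ^ 2 =
        Real.exp (t / 2) ^ 2 + 2 * (Real.exp (t / 2) * Real.exp (-(t / 2))) +
          Real.exp (-(t / 2)) ^ 2 := by ring
    rw [h, e3, ← e1, ← e2]
    ring
  have h2 : Real.cosh (t / 2) ≤ Real.exp ((t / 2) ^ 2 / 2) := Real.cosh_le_exp_half_sq _
  have h3 : (2 * Real.cosh (t / 2)) ^ 2 ≤ (2 * Real.exp ((t / 2) ^ 2 / 2)) ^ 2 :=
    pow_le_pow_left₀ (by linarith [Real.cosh_pos (t / 2)]) (by linarith) 2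
  have h4 : (2 * Real.exp ((t / 2) ^ 2 / 2)) ^ 2 = 4 * Real.exp (t ^ 2 / 4) := by
    rw [mul_pow, ← Real.exp_nat_mul]
    ring_nf
  linarith [h1, h3, h4]

/-- **Axis projections**: `Σ_{v} e^{t e_v(c)} = e^t + e^{-t} + 2 ≤ 4 e^{t²/4}`. [folklore] -/
theorem sum_exp_mul_stepVec_apply_le (t : ℝ) (c : Fin 2) :
    ∑ v : Dir 2, Real.exp (t * (stepVec v c : ℝ)) ≤ 4 * Real.exp (t ^ 2 / 4) := by
  have h : ∑ v : Dir 2, Real.exp (t * (stepVec v c : ℝ)) = Real.exp t + Real.exp (-t) + 2 := by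
    rw [Fintype.sum_prod_type, Fin.sum_univ_two, Fintype.sum_bool, Fintype.sum_bool]
    fin_cases c <;> simp [stepVec] <;> ring
  rw [h]
  exact exp_add_exp_neg_add_two_le t

/-- **Diagonal projections**: `Σ_{v} e^{± t} = 2(e^t + e^{-t}) = 4 cosh t ≤ 4 e^{t²/2}`, for the
weights `e_v(0) + e_v(1)` and `e_v(0) - e_v(1)` (both `±1`). [folklore] -/
theorem sum_exp_mul_diag_le (t : ℝ) :
    ∑ v : Dir 2, Real.exp (t * ((stepVec v 0 : ℝ) + (stepVec v 1 : ℝ))) ≤ 4 * Real.exp (t ^ 2 / 2) ∧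
    ∑ v : Dir 2, Real.exp (t * ((stepVec v 0 : ℝ) - (stepVec v 1 : ℝ))) ≤ 4 * Real.exp (t ^ 2 / 2) := by
  have hc : Real.exp t + Real.exp (-t) ≤ 2 * Real.exp (t ^ 2 / 2) := by
    have := Real.cosh_le_exp_half_sq t
    rw [Real.cosh_eq] at this
    linarith
  constructor
  · have h : ∑ v : Dir 2, Real.exp (t * ((stepVec v 0 : ℝ) + (stepVec v 1 : ℝ))) =
        2 * (Real.exp t + Real.exp (-t)) := by
      rw [Fintype.sum_prod_type, Fin.sum_univ_two, Fintype.sum_bool, Fintype.sum_bool]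
      simp [stepVec]
      ring
    rw [h]
    linarith
  · have h : ∑ v : Dir 2, Real.exp (t * ((stepVec v 0 : ℝ) - (stepVec v 1 : ℝ))) =
        2 * (Real.exp t + Real.exp (-t)) := by
      rw [Fintype.sum_prod_type, Fin.sum_univ_two, Fintype.sum_bool, Fintype.sum_bool]
      simp [stepVec]
      ring
    rw [h]
    linarith

open Classical in
/-- **Gaussian tail of an axis coordinate**: `#{ω : ω(ℓ)_c ≥ a} ≤ 4^ℓ e^{-a²/ℓ}` (`a ≥ 0`, `ℓ ≥ 1`;
Chernoff with `t = 2a/ℓ`). [folklore] -/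
theorem card_filter_pos_apply_ge_le {ℓ : ℕ} (hℓ : 1 ≤ ℓ) (c : Fin 2) {a : ℝ} (ha : 0 ≤ a) :
    (#{ω : StepSeq 2 ℓ | a ≤ (pos ω ℓ c : ℝ)} : ℝ) ≤ 4 ^ ℓ * Real.exp (-(a ^ 2 / ℓ)) := by
  have hℓ' : (0 : ℝ) < ℓ := by exact_mod_cast hℓ
  have h := card_filter_psum_ge_le_exp (fun v : Dir 2 => stepVec v c) ℓ a
    (t := 2 * a / ℓ) (by positivity)
  simp only [psum_stepVec_apply] at h
  refine h.trans ?_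
  calc Real.exp (-(2 * a / ℓ * a)) * (∑ b : Dir 2, Real.exp (2 * a / ℓ * (stepVec b c : ℝ))) ^ ℓ
      ≤ Real.exp (-(2 * a / ℓ * a)) * (4 * Real.exp ((2 * a / ℓ) ^ 2 / 4)) ^ ℓ :=
        mul_le_mul_of_nonneg_left (pow_le_pow_left₀
          (Finset.sum_nonneg fun _ _ => (Real.exp_pos _).le) (sum_exp_mul_stepVec_apply_le _ c) ℓ)
          (Real.exp_pos _).le
    _ = 4 ^ ℓ * Real.exp (-(a ^ 2 / ℓ)) := by
        rw [mul_pow, ← Real.exp_nat_mul, mul_comm (Real.exp _), mul_assoc, ← Real.exp_add]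
        congr 2
        field_simp
        ring

open Classical in
/-- **Gaussian tail of a diagonal coordinate**: `#{ω : ω(ℓ)₀ ± ω(ℓ)₁ ≥ b} ≤ 4^ℓ e^{-b²/(2ℓ)}`
(`b ≥ 0`, `ℓ ≥ 1`; Chernoff with `t = b/ℓ`). [folklore] -/
theorem card_filter_diag_ge_le {ℓ : ℕ} (hℓ : 1 ≤ ℓ) {b : ℝ} (hb : 0 ≤ b) :
    (#{ω : StepSeq 2 ℓ | b ≤ (pos ω ℓ 0 : ℝ) + (pos ω ℓ 1 : ℝ)} : ℝ) ≤
        4 ^ ℓ * Real.exp (-(b ^ 2 / (2 * ℓ))) ∧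
      (#{ω : StepSeq 2 ℓ | b ≤ (pos ω ℓ 0 : ℝ) - (pos ω ℓ 1 : ℝ)} : ℝ) ≤
        4 ^ ℓ * Real.exp (-(b ^ 2 / (2 * ℓ))) := by
  have hℓ' : (0 : ℝ) < ℓ := by exact_mod_cast hℓ
  have hfin : ∀ (S : ℝ), S ≤ 4 * Real.exp ((b / ℓ) ^ 2 / 2) → 0 ≤ S →
      Real.exp (-(b / ℓ * b)) * S ^ ℓ ≤ 4 ^ ℓ * Real.exp (-(b ^ 2 / (2 * ℓ))) := by
    intro S hS hS0
    calc Real.exp (-(b / ℓ * b)) * S ^ ℓ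
        ≤ Real.exp (-(b / ℓ * b)) * (4 * Real.exp ((b / ℓ) ^ 2 / 2)) ^ ℓ :=
          mul_le_mul_of_nonneg_left (pow_le_pow_left₀ hS0 hS ℓ) (Real.exp_pos _).le
      _ = 4 ^ ℓ * Real.exp (-(b ^ 2 / (2 * ℓ))) := by
          rw [mul_pow, ← Real.exp_nat_mul, mul_comm (Real.exp _), mul_assoc, ← Real.exp_add]
          congr 2
          field_simp
          ring
  constructor
  · have h := card_filter_psum_ge_le_exp (fun v : Dir 2 => stepVec v 0 + stepVec v 1) ℓ b
      (t := b / ℓ) (by positivity)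
    simp only [psum_diag, Int.cast_add] at h
    exact h.trans (hfin _ (sum_exp_mul_diag_le _).1
      (Finset.sum_nonneg fun _ _ => (Real.exp_pos _).le))
  · have h := card_filter_psum_ge_le_exp (fun v : Dir 2 => stepVec v 0 - stepVec v 1) ℓ b
      (t := b / ℓ) (by positivity)
    simp only [psum_antidiag, Int.cast_sub] at h
    exact h.trans (hfin _ (sum_exp_mul_diag_le _).2
      (Finset.sum_nonneg fun _ _ => (Real.exp_pos _).le))

/-- **Covering of the circle by the eight lattice directions**: some projection of `(x, y)` onto one
of the lines `x`, `y`, `x + y`, `x - y` has squared length at least `21/25` of `x² + y²`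
(`cos²(π/8) = 0.853… > 21/25`). [folklore] -/
theorem covering (x y : ℝ) :
    21 / 25 * (x ^ 2 + y ^ 2) ≤ x ^ 2 ∨ 21 / 25 * (x ^ 2 + y ^ 2) ≤ y ^ 2 ∨
      42 / 25 * (x ^ 2 + y ^ 2) ≤ (x + y) ^ 2 ∨ 42 / 25 * (x ^ 2 + y ^ 2) ≤ (x - y) ^ 2 := by
  by_cases h1 : 21 * y ^ 2 ≤ 4 * x ^ 2
  · exact Or.inl (by nlinarith)
  by_cases h2 : 21 * x ^ 2 ≤ 4 * y ^ 2
  · exact Or.inr (Or.inl (by nlinarith))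
  have h1' : 4 * x ^ 2 < 21 * y ^ 2 := not_le.1 h1
  have h2' : 4 * y ^ 2 < 21 * x ^ 2 := not_le.1 h2
  -- now the diagonal through the quadrant of `(x, y)` works: `17 (x² + y²) ≤ 50 |x y|`
  have hprod : 0 < (21 * y ^ 2 - 4 * x ^ 2) * (21 * x ^ 2 - 4 * y ^ 2) :=
    mul_pos (by linarith) (by linarith)
  have hxy0 : 0 ≤ x ^ 2 * y ^ 2 := by positivity
  have h4 : (17 * (x ^ 2 + y ^ 2)) ^ 2 ≤ (50 * |x * y|) ^ 2 := by
    rw [mul_pow (50 : ℝ), sq_abs]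
    nlinarith
  have h5 : 17 * (x ^ 2 + y ^ 2) ≤ 50 * |x * y| :=
    (pow_le_pow_iff_left₀ (by positivity) (by positivity) two_ne_zero).1 h4
  by_cases hxy : 0 ≤ x * y
  · refine Or.inr (Or.inr (Or.inl ?_))
    rw [abs_of_nonneg hxy] at h5
    nlinarith
  · refine Or.inr (Or.inr (Or.inr ?_))
    rw [abs_of_neg (not_le.1 hxy)] at h5
    nlinarith

/-- From `c² ≤ z²` with `c ≥ 0` to `c ≤ |z|`. [folklore] -/
theorem le_abs_of_sq_le_sq {c z : ℝ} (hc : 0 ≤ c) (h : c ^ 2 ≤ z ^ 2) : c ≤ |z| :=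
  (pow_le_pow_iff_left₀ hc (abs_nonneg z) two_ne_zero).1 (by rwa [sq_abs])

open Classical in
/-- Tail of the running maximum of one axis coordinate in absolute value:
`#{ω : ∃ j ≤ ℓ, |ω(j)_c| ≥ a} ≤ 4 · 4^ℓ e^{-a²/ℓ}` (`a > 0`). [folklore] -/
theorem card_filter_exists_abs_pos_apply_ge_le {ℓ : ℕ} (hℓ : 1 ≤ ℓ) (c : Fin 2) {a : ℝ}
    (ha : 0 < a) :
    (#{ω : StepSeq 2 ℓ | ∃ j ≤ ℓ, a ≤ |(pos ω j c : ℝ)|} : ℝ) ≤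
      4 * (4 ^ ℓ * Real.exp (-(a ^ 2 / ℓ))) := by
  have h1 := card_filter_max_abs_ge_le (n := ℓ) (fun v : Dir 2 => stepVec v c) (ν := Dir.neg)
    (fun v => Dir.neg_neg v) (fun v => stepVec_neg_apply v c) a
  simp only [psum_stepVec_apply] at h1
  have h2 := card_filter_pos_apply_ge_le hℓ c ha.le
  have h1' : (#{ω : StepSeq 2 ℓ | ∃ j ≤ ℓ, a ≤ |(pos ω j c : ℝ)|} : ℝ) ≤
      4 * #{ω : StepSeq 2 ℓ | a ≤ (pos ω ℓ c : ℝ)} := by exact_mod_cast h1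
  linarith

open Classical in
/-- Tail of the running maximum of the two diagonal coordinates in absolute value:
`#{ω : ∃ j ≤ ℓ, |ω(j)₀ ± ω(j)₁| ≥ b} ≤ 4 · 4^ℓ e^{-b²/(2ℓ)}` (`b > 0`). [folklore] -/
theorem card_filter_exists_abs_diag_ge_le {ℓ : ℕ} (hℓ : 1 ≤ ℓ) {b : ℝ} (hb : 0 < b) :
    (#{ω : StepSeq 2 ℓ | ∃ j ≤ ℓ, b ≤ |(pos ω j 0 : ℝ) + (pos ω j 1 : ℝ)|} : ℝ) ≤
        4 * (4 ^ ℓ * Real.exp (-(b ^ 2 / (2 * ℓ)))) ∧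
      (#{ω : StepSeq 2 ℓ | ∃ j ≤ ℓ, b ≤ |(pos ω j 0 : ℝ) - (pos ω j 1 : ℝ)|} : ℝ) ≤
        4 * (4 ^ ℓ * Real.exp (-(b ^ 2 / (2 * ℓ)))) := by
  constructor
  · have h1 := card_filter_max_abs_ge_le (n := ℓ) (fun v : Dir 2 => stepVec v 0 + stepVec v 1)
      (ν := Dir.neg) (fun v => Dir.neg_neg v)
      (fun v => by rw [stepVec_neg_apply, stepVec_neg_apply]; ring) b
    simp only [psum_diag, Int.cast_add] at h1
    have h1' : (#{ω : StepSeq 2 ℓ | ∃ j ≤ ℓ, b ≤ |(pos ω j 0 : ℝ) + (pos ω j 1 : ℝ)|} : ℝ) ≤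
        4 * #{ω : StepSeq 2 ℓ | b ≤ (pos ω ℓ 0 : ℝ) + (pos ω ℓ 1 : ℝ)} := by exact_mod_cast h1
    have h2 := (card_filter_diag_ge_le hℓ hb.le).1
    linarith
  · have h1 := card_filter_max_abs_ge_le (n := ℓ) (fun v : Dir 2 => stepVec v 0 - stepVec v 1)
      (ν := Dir.neg) (fun v => Dir.neg_neg v)
      (fun v => by rw [stepVec_neg_apply, stepVec_neg_apply]; ring) b
    simp only [psum_antidiag, Int.cast_sub] at h1
    have h1' : (#{ω : StepSeq 2 ℓ | ∃ j ≤ ℓ, b ≤ |(pos ω j 0 : ℝ) - (pos ω j 1 : ℝ)|} : ℝ) ≤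
        4 * #{ω : StepSeq 2 ℓ | b ≤ (pos ω ℓ 0 : ℝ) - (pos ω ℓ 1 : ℝ)} := by exact_mod_cast h1
    have h2 := (card_filter_diag_ge_le hℓ hb.le).2
    linarith

open Classical in
/-- **Gaussian tail of the running maximum of the planar walk**:
`#{ω : ∃ j ≤ ℓ, |ω(j)|² ≥ s²} ≤ 16 · 4^ℓ · e^{-(21/25) s²/ℓ}` for `ℓ ≥ 1`, `s > 0`
(covering by the eight lattice directions, reflection principle, sharp Chernoff bounds).
[folklore] -/
theorem card_filter_exists_normSq_ge_le {ℓ : ℕ} (hℓ : 1 ≤ ℓ) {s : ℝ} (hs : 0 < s) :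
    (#{ω : StepSeq 2 ℓ | ∃ j ≤ ℓ, s ^ 2 ≤ (pos ω j 0 : ℝ) ^ 2 + (pos ω j 1 : ℝ) ^ 2} : ℝ) ≤
      16 * 4 ^ ℓ * Real.exp (-(21 / 25 * s ^ 2 / ℓ)) := by
  set a : ℝ := Real.sqrt (21 / 25) * s with ha_def
  set b : ℝ := Real.sqrt (42 / 25) * s with hb_def
  have ha : 0 < a := by positivity
  have hb : 0 < b := by positivity
  have ha2 : a ^ 2 = 21 / 25 * s ^ 2 := by
    rw [ha_def, mul_pow, Real.sq_sqrt (by norm_num)]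
  have hb2 : b ^ 2 = 42 / 25 * s ^ 2 := by
    rw [hb_def, mul_pow, Real.sq_sqrt (by norm_num)]
  set FX : Finset (StepSeq 2 ℓ) := {ω | ∃ j ≤ ℓ, a ≤ |(pos ω j 0 : ℝ)|} with hFX
  set FY : Finset (StepSeq 2 ℓ) := {ω | ∃ j ≤ ℓ, a ≤ |(pos ω j 1 : ℝ)|} with hFY
  set FU : Finset (StepSeq 2 ℓ) := {ω | ∃ j ≤ ℓ, b ≤ |(pos ω j 0 : ℝ) + (pos ω j 1 : ℝ)|} with hFU
  set FV : Finset (StepSeq 2 ℓ) := {ω | ∃ j ≤ ℓ, b ≤ |(pos ω j 0 : ℝ) - (pos ω j 1 : ℝ)|} with hFV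
  have hsub : ({ω : StepSeq 2 ℓ | ∃ j ≤ ℓ, s ^ 2 ≤ (pos ω j 0 : ℝ) ^ 2 + (pos ω j 1 : ℝ) ^ 2} :
      Finset (StepSeq 2 ℓ)) ⊆ FX ∪ FY ∪ FU ∪ FV := by
    intro ω hω
    rw [Finset.mem_filter] at hω
    obtain ⟨j, hj, hjs⟩ := hω.2
    simp only [hFX, hFY, hFU, hFV, Finset.mem_union, Finset.mem_filter, Finset.mem_univ, true_and]
    rcases covering (pos ω j 0 : ℝ) (pos ω j 1 : ℝ) with h | h | h | h
    · exact Or.inl (Or.inl (Or.inl ⟨j, hj, le_abs_of_sq_le_sq ha.le (by rw [ha2]; linarith)⟩))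
    · exact Or.inl (Or.inl (Or.inr ⟨j, hj, le_abs_of_sq_le_sq ha.le (by rw [ha2]; linarith)⟩))
    · exact Or.inl (Or.inr ⟨j, hj, le_abs_of_sq_le_sq hb.le (by rw [hb2]; linarith)⟩)
    · exact Or.inr ⟨j, hj, le_abs_of_sq_le_sq hb.le (by rw [hb2]; linarith)⟩
  have hX := card_filter_exists_abs_pos_apply_ge_le hℓ 0 ha
  have hY := card_filter_exists_abs_pos_apply_ge_le hℓ 1 ha
  have hUV := card_filter_exists_abs_diag_ge_le hℓ hb
  have hexpa : Real.exp (-(a ^ 2 / ℓ)) = Real.exp (-(21 / 25 * s ^ 2 / ℓ)) := by rw [ha2]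
  have hexpb : Real.exp (-(b ^ 2 / (2 * ℓ))) = Real.exp (-(21 / 25 * s ^ 2 / ℓ)) := by
    rw [hb2]; congr 1; ring
  rw [hexpa] at hX hY
  rw [hexpb] at hUV
  calc (#({ω : StepSeq 2 ℓ | ∃ j ≤ ℓ, s ^ 2 ≤ (pos ω j 0 : ℝ) ^ 2 + (pos ω j 1 : ℝ) ^ 2} :
          Finset (StepSeq 2 ℓ)) : ℝ)
      ≤ #(FX ∪ FY ∪ FU ∪ FV) := by exact_mod_cast Finset.card_le_card hsub
    _ ≤ (#FX : ℝ) + #FY + #FU + #FV := by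
        have h := (Finset.card_union_le (FX ∪ FY ∪ FU) FV).trans
          (Nat.add_le_add_right ((Finset.card_union_le (FX ∪ FY) FU).trans
            (Nat.add_le_add_right (Finset.card_union_le FX FY) _)) _)
        exact_mod_cast h
    _ ≤ 16 * 4 ^ ℓ * Real.exp (-(21 / 25 * s ^ 2 / ℓ)) := by
        rw [hFX, hFY, hFU, hFV]
        linarith [hX, hY, hUV.1, hUV.2]

/-! ### The running maximum of the squared norm and its exponential moment -/

/-- The running maximum `max_{j ≤ ℓ} |ω(j)|²` of the squared Euclidean norm along the path, as a
natural number. [folklore] -/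
def maxNormSq {ℓ : ℕ} (ω : StepSeq 2 ℓ) : ℕ :=
  (Finset.range (ℓ + 1)).sup fun j => ((pos ω j 0) ^ 2 + (pos ω j 1) ^ 2).toNat

/-- Every squared norm along the path is at most the running maximum. [folklore] -/
theorem normSq_le_maxNormSq {ℓ : ℕ} (ω : StepSeq 2 ℓ) {j : ℕ} (hj : j ≤ ℓ) :
    (pos ω j 0) ^ 2 + (pos ω j 1) ^ 2 ≤ (maxNormSq ω : ℤ) := by
  have h : ((pos ω j 0) ^ 2 + (pos ω j 1) ^ 2).toNat ≤ maxNormSq ω :=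
    Finset.le_sup (f := fun j => ((pos ω j 0) ^ 2 + (pos ω j 1) ^ 2).toNat)
      (Finset.mem_range.2 (Nat.lt_succ_of_le hj))
  have h0 : 0 ≤ (pos ω j 0) ^ 2 + (pos ω j 1) ^ 2 := by positivity
  calc (pos ω j 0) ^ 2 + (pos ω j 1) ^ 2 = ((((pos ω j 0) ^ 2 + (pos ω j 1) ^ 2).toNat : ℕ) : ℤ) :=
        (Int.toNat_of_nonneg h0).symm
    _ ≤ (maxNormSq ω : ℤ) := by exact_mod_cast h

/-- The running maximum is attained: if it is `≥ u` then some squared norm along the path is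
`≥ u`. [folklore] -/
theorem exists_normSq_ge_of_le_maxNormSq {ℓ : ℕ} (ω : StepSeq 2 ℓ) {u : ℕ} (h : u ≤ maxNormSq ω) :
    ∃ j ≤ ℓ, (u : ℤ) ≤ (pos ω j 0) ^ 2 + (pos ω j 1) ^ 2 := by
  obtain ⟨j, hj, hj'⟩ := Finset.exists_mem_eq_sup (Finset.range (ℓ + 1)) ⟨0, by simp⟩
    (fun j => ((pos ω j 0) ^ 2 + (pos ω j 1) ^ 2).toNat)
  refine ⟨j, Nat.le_of_lt_succ (Finset.mem_range.1 hj), ?_⟩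
  have h' : u ≤ ((pos ω j 0) ^ 2 + (pos ω j 1) ^ 2).toNat := by
    rw [maxNormSq, hj'] at h
    exact h
  have h0 : 0 ≤ (pos ω j 0) ^ 2 + (pos ω j 1) ^ 2 := by positivity
  calc (u : ℤ) ≤ ((((pos ω j 0) ^ 2 + (pos ω j 1) ^ 2).toNat : ℕ) : ℤ) := by exact_mod_cast h'
    _ = (pos ω j 0) ^ 2 + (pos ω j 1) ^ 2 := Int.toNat_of_nonneg h0

/-- The running maximum of an `ℓ`-step walk is at most `2ℓ²`. [folklore] -/
theorem maxNormSq_le {ℓ : ℕ} (ω : StepSeq 2 ℓ) : maxNormSq ω ≤ 2 * ℓ ^ 2 := by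
  refine Finset.sup_le fun j hj => ?_
  have hj' : j ≤ ℓ := Nat.le_of_lt_succ (Finset.mem_range.1 hj)
  have hb := pos_mem_box ω j
  rw [mem_box] at hb
  obtain ⟨h0l, h0u⟩ := hb 0
  obtain ⟨h1l, h1u⟩ := hb 1
  have hjl : (j : ℤ) ≤ ℓ := by exact_mod_cast hj'
  have hsq : (pos ω j 0) ^ 2 + (pos ω j 1) ^ 2 ≤ 2 * (ℓ : ℤ) ^ 2 := by
    nlinarith [abs_le.2 ⟨h0l, h0u⟩, abs_le.2 ⟨h1l, h1u⟩, sq_abs (pos ω j 0), sq_abs (pos ω j 1),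
      abs_nonneg (pos ω j 0), abs_nonneg (pos ω j 1)]
  exact Int.toNat_le.2 (by exact_mod_cast hsq)

/-- **Exponential moment of the running maximum**: for `1 ≤ ℓ ≤ 2n`,
`Σ_{ω ∈ StepSeq 2 ℓ} exp(max_{j ≤ ℓ} |ω(j)|² / (4n)) ≤ 100 · 4^ℓ`, i.e.
`E exp(max_j |S_j|²/(4n)) ≤ 100` for the `ℓ`-step walk (Abel summation against the Gaussian tail:
the rate `21/(25ℓ) ≥ 21/(50n)` beats `1/(4n)`). [folklore] -/
theorem sum_exp_maxNormSq_div_le {n ℓ : ℕ} (hn : 1 ≤ n) (hℓ1 : 1 ≤ ℓ) (hℓ : ℓ ≤ 2 * n) :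
    ∑ ω : StepSeq 2 ℓ, Real.exp ((maxNormSq ω : ℝ) / (4 * n)) ≤ 100 * 4 ^ ℓ := by
  classical
  have hn' : (0 : ℝ) < n := by exact_mod_cast hn
  have hℓ' : (0 : ℝ) < ℓ := by exact_mod_cast hℓ1
  have hℓn : (ℓ : ℝ) ≤ 2 * n := by exact_mod_cast hℓ
  set K : ℕ := 2 * ℓ ^ 2 + 1 with hK
  set g : ℕ → ℝ := fun u => Real.exp ((u : ℝ) / (4 * n)) with hg
  -- Abel summation, pathwise: `g(m) = 1 + Σ_{u < K} [u < m] (g(u+1) - g(u))`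
  have habel : ∀ ω : StepSeq 2 ℓ, g (maxNormSq ω) =
      1 + ∑ u ∈ Finset.range K, if u < maxNormSq ω then g (u + 1) - g u else 0 := by
    intro ω
    have hmK : maxNormSq ω ≤ K := (maxNormSq_le ω).trans (Nat.le_succ _)
    have htel := Finset.sum_range_sub g (maxNormSq ω)
    have hg0 : g 0 = 1 := by simp [hg]
    rw [hg0] at htel
    rw [← Finset.sum_range_add_sum_Ico _ hmK, Finset.sum_congr rfl fun u hu =>
      if_pos (Finset.mem_range.1 hu), Finset.sum_eq_zero (s := Finset.Ico (maxNormSq ω) K)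
      fun u hu => if_neg (not_lt.2 (Finset.mem_Ico.1 hu).1), add_zero, htel]
    ring
  -- the tail, in the form needed
  have htail : ∀ u : ℕ, (#{ω : StepSeq 2 ℓ | u < maxNormSq ω} : ℝ) ≤
      16 * 4 ^ ℓ * Real.exp (-(21 / 50 * u / n)) := by
    intro u
    have hs : (0 : ℝ) < Real.sqrt (u + 1) := Real.sqrt_pos.2 (by positivity)
    have h := card_filter_exists_normSq_ge_le hℓ1 hs
    rw [Real.sq_sqrt (by positivity)] at h
    calc (#{ω : StepSeq 2 ℓ | u < maxNormSq ω} : ℝ)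
        ≤ #{ω : StepSeq 2 ℓ | ∃ j ≤ ℓ, ((u : ℝ) + 1) ≤ (pos ω j 0 : ℝ) ^ 2 + (pos ω j 1 : ℝ) ^ 2} := by
          have hsub : ({ω : StepSeq 2 ℓ | u < maxNormSq ω} : Finset (StepSeq 2 ℓ)) ⊆
              ({ω : StepSeq 2 ℓ | ∃ j ≤ ℓ, ((u : ℝ) + 1) ≤ (pos ω j 0 : ℝ) ^ 2 + (pos ω j 1 : ℝ) ^ 2} :
                Finset (StepSeq 2 ℓ)) := by
            intro ω hω
            rw [Finset.mem_filter] at hω ⊢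
            obtain ⟨j, hj, hju⟩ := exists_normSq_ge_of_le_maxNormSq ω (Nat.succ_le_of_lt hω.2)
            refine ⟨hω.1, j, hj, ?_⟩
            exact_mod_cast hju
          exact_mod_cast Finset.card_le_card hsub
      _ ≤ 16 * 4 ^ ℓ * Real.exp (-(21 / 25 * ((u : ℝ) + 1) / ℓ)) := h
      _ ≤ 16 * 4 ^ ℓ * Real.exp (-(21 / 50 * u / n)) := by
          refine mul_le_mul_of_nonneg_left (Real.exp_le_exp.2 ?_) (by positivity)
          -- `21/50 · u/n ≤ 21/25 · (u+1)/ℓ` since `ℓ ≤ 2n`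
          rw [neg_le_neg_iff, div_le_div_iff₀ hn' hℓ']
          have hu : (0 : ℝ) ≤ u := Nat.cast_nonneg u
          nlinarith [mul_le_mul_of_nonneg_left hℓn hu]
  -- the increments of `g`
  have hincr : ∀ u : ℕ, g (u + 1) - g u ≤ g u / (2 * n) := by
    intro u
    have h1 : g (u + 1) = g u * Real.exp (1 / (4 * n)) := by
      rw [hg]; dsimp only; rw [← Real.exp_add]; congr 1; push_cast; ring
    have hn1 : (1 : ℝ) ≤ n := by exact_mod_cast hn
    have h2 : Real.exp (1 / (4 * n)) - 1 ≤ 2 * (1 / (4 * n)) := by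
      have hx : |(1 : ℝ) / (4 * n)| ≤ 1 := by
        rw [abs_of_nonneg (by positivity), div_le_one (by positivity)]; linarith
      have := Real.abs_exp_sub_one_le hx
      rw [abs_of_nonneg (show (0 : ℝ) ≤ 1 / (4 * n) by positivity)] at this
      exact (le_abs_self _).trans this
    have hgpos : 0 < g u := Real.exp_pos _
    rw [h1]
    have : g u * Real.exp (1 / (4 * ↑n)) - g u = g u * (Real.exp (1 / (4 * n)) - 1) := by ring
    rw [this]
    calc g u * (Real.exp (1 / (4 * n)) - 1) ≤ g u * (2 * (1 / (4 * n))) :=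
          mul_le_mul_of_nonneg_left h2 hgpos.le
      _ = g u / (2 * n) := by field_simp; ring
  -- the geometric sum `Σ_u r^u`, `r = e^{-(17/100)/n}`
  set r : ℝ := Real.exp (-(17 / 100 / n)) with hr
  have hr0 : 0 ≤ r := (Real.exp_pos _).le
  have hr1 : r < 1 := by
    have h : Real.exp (-(17 / 100 / n)) < Real.exp 0 :=
      Real.exp_lt_exp.2 (by rw [neg_lt_zero]; positivity)
    rwa [Real.exp_zero] at h
  have hx0 : (0 : ℝ) < 17 / 100 / n := by positivity
  have h1r : 17 / 100 / (n : ℝ) / 2 ≤ 1 - r := by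
    have h1 : 17 / 100 / (n : ℝ) + 1 ≤ Real.exp (17 / 100 / n) := Real.add_one_le_exp _
    have h2 : r = (Real.exp (17 / 100 / n))⁻¹ := by rw [hr, Real.exp_neg]
    have h3 : (Real.exp (17 / 100 / (n : ℝ)))⁻¹ ≤ (17 / 100 / (n : ℝ) + 1)⁻¹ :=
      inv_anti₀ (by positivity) h1
    have h4 : (17 / 100 / (n : ℝ) + 1)⁻¹ = 1 - (17 / 100 / n) / (17 / 100 / n + 1) := by
      field_simp
      ring
    have hn1 : (1 : ℝ) ≤ n := by exact_mod_cast hn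
    have hx1 : 17 / 100 / (n : ℝ) ≤ 1 := by
      rw [div_le_one hn']
      linarith
    have h5 : 17 / 100 / (n : ℝ) / 2 ≤ (17 / 100 / n) / (17 / 100 / n + 1) :=
      div_le_div_of_nonneg_left hx0.le (by positivity) (by linarith)
    rw [h2]
    linarith [h3, h4, h5]
  have hgeom : ∑ u ∈ Finset.range K, r ^ u ≤ 1 / (1 - r) := by
    rw [geom_sum_eq hr1.ne K]
    have h1 : (r ^ K - 1) / (r - 1) = (1 - r ^ K) / (1 - r) := by
      rw [← neg_sub 1 (r ^ K), ← neg_sub 1 r, neg_div_neg_eq]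
    rw [h1]
    exact div_le_div_of_nonneg_right (by linarith [pow_nonneg hr0 K]) (by linarith)
  have hterm : ∀ u : ℕ, g u * Real.exp (-(21 / 50 * u / n)) = r ^ u := by
    intro u
    rw [hg, hr]
    dsimp only
    rw [← Real.exp_add, ← Real.exp_nat_mul]
    congr 1
    field_simp
    ring
  -- main computation
  calc ∑ ω : StepSeq 2 ℓ, Real.exp ((maxNormSq ω : ℝ) / (4 * n))
      = ∑ ω : StepSeq 2 ℓ, g (maxNormSq ω) := rfl
    _ = ∑ ω : StepSeq 2 ℓ,
          (1 + ∑ u ∈ Finset.range K, if u < maxNormSq ω then g (u + 1) - g u else 0) :=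
        Finset.sum_congr rfl fun ω _ => habel ω
    _ = 4 ^ ℓ + ∑ u ∈ Finset.range K, (g (u + 1) - g u) * #{ω : StepSeq 2 ℓ | u < maxNormSq ω} := by
        rw [Finset.sum_add_distrib, Finset.sum_const, Finset.card_univ, card_stepSeq, Finset.sum_comm]
        congr 1
        · rw [nsmul_eq_mul, mul_one]
          norm_num
        · refine Finset.sum_congr rfl fun u _ => ?_
          rw [← Finset.sum_filter, Finset.sum_const, nsmul_eq_mul, mul_comm]
    _ ≤ 4 ^ ℓ + ∑ u ∈ Finset.range K,
          (g u / (2 * n)) * (16 * 4 ^ ℓ * Real.exp (-(21 / 50 * u / n))) := by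
        refine add_le_add le_rfl (Finset.sum_le_sum fun u _ => ?_)
        refine mul_le_mul (hincr u) (htail u) (Nat.cast_nonneg _) ?_
        exact div_nonneg (Real.exp_pos _).le (by positivity)
    _ = 4 ^ ℓ + 8 * 4 ^ ℓ / n * ∑ u ∈ Finset.range K, r ^ u := by
        rw [Finset.mul_sum]
        congr 1
        refine Finset.sum_congr rfl fun u _ => ?_
        rw [← hterm u]
        ring
    _ ≤ 4 ^ ℓ + 8 * 4 ^ ℓ / n * (1 / (1 - r)) := by gcongr
    _ ≤ 4 ^ ℓ + 8 * 4 ^ ℓ / n * (1 / (17 / 100 / (n : ℝ) / 2)) := by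
        have h := one_div_le_one_div_of_le (by positivity) h1r
        gcongr
    _ ≤ 100 * 4 ^ ℓ := by
        have h4 : (0 : ℝ) < 4 ^ ℓ := pow_pos (by norm_num) ℓ
        have hc : 8 * 4 ^ ℓ / (n : ℝ) * (1 / (17 / 100 / (n : ℝ) / 2)) = 1600 / 17 * 4 ^ ℓ := by
          rw [one_div_div, show (17 : ℝ) / 100 / n = 17 / (100 * n) by rw [div_div]]
          rw [div_div_eq_mul_div]
          field_simp
          norm_num
        rw [hc]
        nlinarith [h4]

end Planar

end PlaneNonIntersection

end Literature.Probability.RandomPlanarGeometry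

end
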